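import Summits.CriticalPhenomena.Ising3D.TaylorTableHeadPartsL
import HarnessLib

/-!
# The TABLE layer of a derivative certificate, XXXIV: GROUP parts for the EVEN δ head layer
(cell `pub-ising3x`, seat boot-1 gen 10; gate (g2) — the even-sector twin of `oddHeadPartOKΔ_of_group` in `TaylorTableHeadPartsL`)

HONEST FRAMING: lottery ticket; floor = tightest certified 3D Ising CFT bounds; no exact-solution
claim without a proof. Island framing: certified exclusion region at stated derivative order and
assumptions; not a determination of the 3D Ising critical exponents beyond that.

The replay layout measured in HEAD-DELTA.md §8 (one-term parts against a literal Taylor-model table, ≈ 20 parts per file, the cell's final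
sign test on a short list of GROUP parts) needs, for the even sector, the analogue of the odd group theorem: a part `g : HeadPart3` whose
term range is tiled by a chain `ps` of parts (`groupTiles3`) that each pass the literal-table check `evenPartOKL R C tms`, and whose claimed
triples contain the summed claims `sum3X/sum3Y/sum3Z ps` (`groupClaimsOK3`, one cheap decide), passes `evenPartOKL R C tms g` — proved by
list induction (`headPolyTM_append`, `subsetI_addI`, `subsetI_trans` from file XXXII), never evaluated on the many-term part. With the table
equality (or the position-wise agreement of file XXXIII) this gives the landed `evenHeadPartOKΔ R C g = true`, so `evenHeadPartsFinalOKΔ` and the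
cell theorems run on the group parts. Elementary given the tree. [folklore]
-/

namespace Summit.CriticalPhenomena.Ising3D

open Literature.Analysis.ValidatedNumerics Literature.Analysis.ValidatedNumerics.PolyMP
open Literature.Analysis.ValidatedNumerics.NumericsMP (MI)
open Literature.MathematicalPhysics.QuantumFieldTheory.ConformalBootstrap3D
open Literature.MathematicalPhysics.QuantumFieldTheory.ConformalBootstrap3D.HRTM (rowEntry pivOK)

/-- The parts form a chain from `pos` (even sector, triple claims). [folklore] -/
def chainFrom3 : ℕ → List HeadPart3 → Bool
  | _, [] => true
  | pos, p :: ps => decide (p.t0 = pos) && chainFrom3 (pos + p.count) ps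

/-- Total number of terms of a list of even parts. [folklore] -/
def countSum3 : List HeadPart3 → ℕ
  | [] => 0
  | p :: ps => p.count + countSum3 ps

/-- The even group tiling check: `ps` is a chain from `g.t0` of total length `g.count`. [folklore] -/
def groupTiles3 (g : HeadPart3) (ps : List HeadPart3) : Bool :=
  chainFrom3 g.t0 ps && decide (countSum3 ps = g.count)

/-- The even group claims check: the summed claimed triples of `ps` are contained in the claims of `g` (9 containments; cheap). [folklore] -/
def groupClaimsOK3 (g : HeadPart3) (ps : List HeadPart3) : Bool :=
  subset3 (sum3X ps) g.PX && subset3 (sum3Y ps) g.PY && subset3 (sum3Z ps) g.PZ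

section Group

variable (S : ℕ) (RX RY RZ : List IPoly) (tms : List (List IPoly)) (C : EvenCellTM)

/-- One order view `f` (`ord0/ord1/ord2`): chained parts whose `f`-views pass the three containments against rows `RX, RY, RZ` enclose the
computed head polynomials of their union slice in the summed `f`-claims. [folklore] -/
theorem computed_subset_sum_of_chain3 (f : HeadPart3 → HeadPart) (hf : ∀ p, (f p).t0 = p.t0 ∧ (f p).count = p.count) :
    ∀ (ps : List HeadPart3) (pos : ℕ),
      (∀ p ∈ ps, subsetI (headPolyTM S RX tms C.nF C.ℓ C.ctr ((f p).slice C.F)) (f p).PX = true ∧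
          subsetI (headPolyTM S RY tms C.nF C.ℓ C.ctr ((f p).slice C.F)) (f p).PY = true ∧
          subsetI (headPolyTM S RZ tms C.nF C.ℓ C.ctr ((f p).slice C.F)) (f p).PZ = true) →
      chainFrom3 pos ps = true →
      subsetI (headPolyTM S RX tms C.nF C.ℓ C.ctr (sliceOf C.F pos (countSum3 ps))) (sumPX (ps.map f)) = true ∧
      subsetI (headPolyTM S RY tms C.nF C.ℓ C.ctr (sliceOf C.F pos (countSum3 ps))) (sumPY (ps.map f)) = true ∧
      subsetI (headPolyTM S RZ tms C.nF C.ℓ C.ctr (sliceOf C.F pos (countSum3 ps))) (sumPZ (ps.map f)) = true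
  | [], pos, _, _ => by
      simp [countSum3, sliceOf, headPolyTM, sumPX, sumPY, sumPZ, subsetI]
  | p :: ps, pos, hok, hch => by
      simp only [chainFrom3, Bool.and_eq_true, decide_eq_true_eq] at hch
      obtain ⟨ht0, hch'⟩ := hch
      obtain ⟨iX, iY, iZ⟩ :=
        computed_subset_sum_of_chain3 f hf ps (pos + p.count) (fun q hq => hok q (List.mem_cons_of_mem _ hq)) hch'
      obtain ⟨hX, hY, hZ⟩ := hok p List.mem_cons_self
      have hsl : (f p).slice C.F = sliceOf C.F pos p.count := by
        rw [HeadPart.slice, (hf p).1, (hf p).2, ht0]; rfl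
      rw [hsl] at hX hY hZ
      have hs : sliceOf C.F pos (countSum3 (p :: ps)) = sliceOf C.F pos p.count ++ sliceOf C.F (pos + p.count) (countSum3 ps) := by
        simp only [countSum3, sliceOf_add]
      rw [hs, headPolyTM_append, headPolyTM_append, headPolyTM_append]
      simp only [List.map_cons, sumPX, sumPY, sumPZ]
      exact ⟨subsetI_addI hX iX, subsetI_addI hY iY, subsetI_addI hZ iZ⟩

/-- `headPartOKWith` unpacked. [folklore] -/
theorem headPartOKWith_iff (Rm : EvenRows) (pm : HeadPart) :
    headPartOKWith tms Rm C pm = true ↔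
      subsetI (headPolyTM Rm.S Rm.RX tms C.nF C.ℓ C.ctr (pm.slice C.F)) pm.PX = true ∧
      subsetI (headPolyTM Rm.S Rm.RY tms C.nF C.ℓ C.ctr (pm.slice C.F)) pm.PY = true ∧
      subsetI (headPolyTM Rm.S Rm.RZ tms C.nF C.ℓ C.ctr (pm.slice C.F)) pm.PZ = true := by
  simp only [headPartOKWith, Bool.and_eq_true, and_assoc]

/-- One order view of the group theorem: from the chain's `headPartOKWith` and the containment of the summed view-claims in the
group's view-claims, the group's view passes `headPartOKWith`. [folklore] -/
theorem headPartOKWith_of_group (Rm : EvenRows) (f : HeadPart3 → HeadPart) (hf : ∀ p, (f p).t0 = p.t0 ∧ (f p).count = p.count)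
    {g : HeadPart3} {ps : List HeadPart3} (htile : groupTiles3 g ps = true)
    (hparts : ∀ p ∈ ps, headPartOKWith tms Rm C (f p) = true)
    (hX : subsetI (sumPX (ps.map f)) (f g).PX = true) (hY : subsetI (sumPY (ps.map f)) (f g).PY = true)
    (hZ : subsetI (sumPZ (ps.map f)) (f g).PZ = true) : headPartOKWith tms Rm C (f g) = true := by
  simp only [groupTiles3, Bool.and_eq_true, decide_eq_true_eq] at htile
  obtain ⟨hch, hcnt⟩ := htile
  have h := computed_subset_sum_of_chain3 Rm.S Rm.RX Rm.RY Rm.RZ tms C f hf ps g.t0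
    (fun p hp => (headPartOKWith_iff tms C Rm (f p)).mp (hparts p hp)) hch
  rw [hcnt] at h
  have hsl : (f g).slice C.F = sliceOf C.F g.t0 g.count := by rw [HeadPart.slice, (hf g).1, (hf g).2]; rfl
  rw [headPartOKWith_iff, hsl]
  exact ⟨subsetI_trans h.1 hX, subsetI_trans h.2.1 hY, subsetI_trans h.2.2 hZ⟩

/-- **GROUP PART THEOREM, even head** (literal-table form). [folklore] -/
theorem evenPartOKL_of_group (R : HeadRowsΔ) {g : HeadPart3} {ps : List HeadPart3} (htile : groupTiles3 g ps = true)
    (hparts : ∀ p ∈ ps, evenPartOKL R C tms p = true) (hclaims : groupClaimsOK3 g ps = true) : evenPartOKL R C tms g = true := by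
  simp only [groupClaimsOK3, Bool.and_eq_true, subset3, sum3X, sum3Y, sum3Z] at hclaims
  obtain ⟨⟨⟨⟨hX0, hX1⟩, hX2⟩, ⟨⟨hY0, hY1⟩, hY2⟩⟩, ⟨⟨hZ0, hZ1⟩, hZ2⟩⟩ := hclaims
  have hp : ∀ p ∈ ps, evenPartOKL R C tms p = true := hparts
  simp only [evenPartOKL, Bool.and_eq_true] at hp ⊢
  refine ⟨⟨?_, ?_⟩, ?_⟩
  · exact headPartOKWith_of_group tms C R.rows0 HeadPart3.ord0 (fun p => ⟨rfl, rfl⟩) htile (fun p h => (hp p h).1.1) hX0 hY0 hZ0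
  · exact headPartOKWith_of_group tms C R.rows1 HeadPart3.ord1 (fun p => ⟨rfl, rfl⟩) htile (fun p h => (hp p h).1.2) hX1 hY1 hZ1
  · exact headPartOKWith_of_group tms C R.rows2 HeadPart3.ord2 (fun p => ⟨rfl, rfl⟩) htile (fun p h => (hp p h).2) hX2 hY2 hZ2

/-- **GROUP PART THEOREM in the landed form, even head**: with the table equality, the group part passes `evenHeadPartOKΔ`. [folklore] -/
theorem evenHeadPartOKΔ_of_group (R : HeadRowsΔ) (ht : HRTM.rows R.S C.ctr C.ℓ C.e C.D C.nF = tms) {g : HeadPart3} {ps : List HeadPart3}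
    (htile : groupTiles3 g ps = true) (hparts : ∀ p ∈ ps, evenPartOKL R C tms p = true) (hclaims : groupClaimsOK3 g ps = true) :
    evenHeadPartOKΔ R C g = true :=
  evenHeadPartOKΔ_of_table ht (evenPartOKL_of_group tms C R htile hparts hclaims)

end Group

end Summit.CriticalPhenomena.Ising3D
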